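import Mathlib.Analysis.SpecialFunctions.Log.Deriv
import Mathlib.Analysis.SpecialFunctions.Pow.Real
import Mathlib.Analysis.SpecialFunctions.Sqrt
import Mathlib.Analysis.Asymptotics.Lemmas
import Mathlib.Algebra.Polynomial.Degree.Lemmas
import Mathlib.Algebra.Polynomial.Eval.Degree
import Mathlib.NumberTheory.Bernoulli
import Mathlib.RingTheory.Polynomial.Pochhammer
import Literature.NumberTheory.LFunctions.XiMomentConcentration
import Literature.NumberTheory.LFunctions.JensenHermite
import HarnessLib

/-!
# GORZ §5.1 eq. (15) for the Taylor coefficients of `ξ` — proved (`xiTaylorCoeff_logRatio_holds`)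

Trunk T-ANT (`Literature/NumberTheory/LFunctions`). Discharges the named fact
`Literature.NumberTheory.LFunctions.xiTaylorCoeff_logRatio` of `JensenHermite.lean`, i.e. Griffin–Ono–Rolen–Zagier, PNAS 116
(2019), §5.1 eq. (15): for every `d ≥ 1` there are `A(n)`, `0 < δ(n) → 0` and
`gᵢ(n) = o(δ(n)ⁱ)` (`3 ≤ i ≤ d`) with
`log(γ(n+j)/γ(n)) = A(n) j - δ(n)² j² + ∑_{i=3}^{d} gᵢ(n) jⁱ + o(δ(n)^d)` for `0 ≤ j ≤ d`,
where `γ(n)` (`Literature.NumberTheory.LFunctions.xiTaylorCoeff`) are the Taylor coefficients of `(-1 + 4z²) Λ(1/2 + z)`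
(GORZ eq. (1)). Together with `xiTaylorCoeff_pos_holds` (`XiMoments.lean`) and
`Literature.NumberTheory.LFunctions.jensenPoly_xiTaylorCoeff_eventually_splits` (`JensenHermite.lean`: GORZ Thm. 3, Thm. 6 and
the Corollary, proved) this yields GORZ Thm. 1, `Literature.NumberTheory.LFunctions.gorz_eventually_holds`
(`EquivalentsProofs.lean`).

## The argument

GORZ derive (15) (with the closed forms (16)–(18) for `A`, `δ`) from the all-orders saddle-point
expansion of Thm. 7. Here (15) — which only asserts existence of `A`, `δ`, `gᵢ` — is obtained
from the moment formula `γ(n) = 64·4ⁿ n!/(2n)! M_{2n}`, `M_k = ∫₀^∞ Φ(u) uᵏ du`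
(`XiMoments.lean`) and the decay `m_l(k) = o(k^{-l/2})` (`l ≥ 1`) of the normalised central
moments of `ν_k ∝ Φ(u) uᵏ du` (`XiMomentConcentration.lean`), by bookkeeping at the scale
`δ₀(n) = (2n)^{-1/2}`:

* Step A (`log_xiTaylorCoeff_add`): `log γ(n+j) - log γ(n) = -∑_{k<j} log(n+k+1/2)
  + (log M_{2n+2j} - log M_{2n})`.
* Step B (`log_xiMoment_ratio`): `log M_{2n+2j} - log M_{2n} = 2j log ū_{2n} + log(1 + E_n(j))`,
  `E_n(j) = ∑_{2≤l≤2d} C(2j,l) m_l(2n)` a polynomial in `j` whose coefficient of `jⁱ` is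
  `o(δ₀ⁱ)` and whose constant term vanishes (a *negligible family*, `Literature.NumberTheory.LFunctions.GORZAsymp.IsNegl`);
  `log(1 + E_n(j))` equals its order-`d` Taylor polynomial `L_d(E)_n(j)` up to `o(δ₀^{d+1})`
  (`isLittleO_log_one_add_sub_logPoly`), and negligible families form an algebra
  (`IsNegl.mul`, `.pow`, `.logPoly`).
* Step C (`sum_log_eq`, `sum_taylor_eq`, `isLittleO_sum_log_sub`): with `y = 1/(n + 1/2)`,
  `∑_{k<j} log(1 + k y) = (y/2)(j² - j) + W_n(j) + o(δ₀^{2d})`, `W_n` negligible (Faulhaber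
  polynomials `Literature.NumberTheory.LFunctions.GORZAsymp.faulhaber`, Mathlib's `Finset.sum_range_pow`).
* Step D (`logRatio_sub_isLittleO`): hence `log(γ(n+j)/γ(n)) = A₀(n) j - (y/2) j² + Q_n(j)
  + o(δ₀^d)` with `Q = L_d(E) - W` negligible.
* Step E (`xiTaylorCoeff_logRatio_of_two_le`, `xiTaylorCoeff_logRatio_holds'`): absorb the
  coefficients `cᵢ(n) = o(δ₀ⁱ)` of `Q_n`: `A = A₀ + c₁`, `δ² = y/2 - c₂ ∼ δ₀²` (so `0 < δ → 0`,
  `δ₀ = O(δ)`), `gᵢ = cᵢ` (`3 ≤ i ≤ d`), remainder `o(δ₀^d) = o(δ^d)`.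

## Contents (all proved)

* `Literature.NumberTheory.LFunctions.GORZAsymp.δ₀`, `Literature.NumberTheory.LFunctions.GORZAsymp.IsNegl` and its closure properties, `logPoly`,
  `faulhaber`, `choosePoly` (`C(2j, l)` as a polynomial in `j`), `yseq`, `Epoly`, `Wpoly`,
  `Qpoly`, `Aseq0`, `cQ`, `Aseq`, `δseq`, `gseq` — the bookkeeping objects of Steps A–E.
* `Literature.NumberTheory.LFunctions.GORZAsymp.xiTaylorCoeff_logRatio_holds'` (eq. (15), all `d ≥ 1`) and the **discharge**
  `Literature.xiTaylorCoeff_logRatio_holds : xiTaylorCoeff_logRatio`.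

## References

* M. Griffin, K. Ono, L. Rolen, D. Zagier, *Jensen polynomials for the Riemann zeta function and
  other sequences*, PNAS 116 (2019) 11103–11110, §5.1, eqs. (15)–(18), and Thm. 7.
  [GORZPNAS2019]
-/

noncomputable section

open Real Filter Topology Asymptotics Polynomial Finset
open scoped Nat

namespace Literature.NumberTheory.LFunctions

namespace GORZAsymp

/-! ### The basic scale `δ₀(n) = (2n)^{-1/2}` -/

/-- `δ₀(n) = 1/√(2n)`. [folklore] -/
def δ₀ (n : ℕ) : ℝ := (Real.sqrt (2 * n))⁻¹

/-- `δ₀(n) > 0` for `n ≥ 1`. [folklore] -/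
theorem δ₀_pos {n : ℕ} (hn : 1 ≤ n) : 0 < δ₀ n := by
  unfold δ₀; have : (0:ℝ) < n := by exact_mod_cast hn
  positivity

/-- `δ₀(n) ≥ 0`. [folklore] -/
theorem δ₀_nonneg (n : ℕ) : 0 ≤ δ₀ n := by unfold δ₀; positivity

/-- `δ₀(n)² = 1/(2n)` for `n ≥ 1`. [folklore] -/
theorem δ₀_sq {n : ℕ} (hn : 1 ≤ n) : δ₀ n ^ 2 = 1 / (2 * n) := by
  unfold δ₀; have : (0:ℝ) < n := by exact_mod_cast hn
  rw [inv_pow, sq_sqrt (by positivity), one_div]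

/-- `δ₀(n) → 0`. [folklore] -/
theorem tendsto_δ₀ : Tendsto δ₀ atTop (𝓝 0) := by
  unfold δ₀
  refine tendsto_inv_atTop_zero.comp ?_
  exact tendsto_sqrt_atTop.comp (tendsto_natCast_atTop_atTop.const_mul_atTop (by norm_num))

/-- `δ₀(n) ≤ 1` for large `n`. [folklore] -/
theorem eventually_δ₀_le_one : ∀ᶠ n in atTop, δ₀ n ≤ 1 := by
  filter_upwards [eventually_ge_atTop 1] with n hn
  unfold δ₀
  have h2 : (1:ℝ) ≤ 2 * n := by
    have : (1:ℝ) ≤ n := by exact_mod_cast hn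
    linarith
  have : 1 ≤ Real.sqrt (2 * n) := by
    rw [show (1:ℝ) = Real.sqrt 1 by simp]; exact sqrt_le_sqrt h2
  exact inv_le_one_of_one_le₀ this

/-- `δ₀(n) > 0` for large `n`. [folklore] -/
theorem eventually_δ₀_pos : ∀ᶠ n in atTop, 0 < δ₀ n :=
  (eventually_ge_atTop 1).mono fun _ hn ↦ δ₀_pos hn

/-- `δ₀^m = O(δ₀^i)` for `i ≤ m`. [folklore] -/
theorem isBigO_δ₀_pow_of_le {i m : ℕ} (h : i ≤ m) :
    (fun n ↦ δ₀ n ^ m) =O[atTop] fun n ↦ δ₀ n ^ i := by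
  refine IsBigO.of_bound' ?_
  filter_upwards [eventually_δ₀_le_one] with n hn
  rw [Real.norm_eq_abs, Real.norm_eq_abs, abs_of_nonneg (pow_nonneg (δ₀_nonneg n) _),
    abs_of_nonneg (pow_nonneg (δ₀_nonneg n) _)]
  exact pow_le_pow_of_le_one (δ₀_nonneg n) hn h

/-- `δ₀^m = o(δ₀^i)` for `i < m`. [folklore] -/
theorem isLittleO_δ₀_pow_of_lt {i m : ℕ} (h : i < m) :
    (fun n ↦ δ₀ n ^ m) =o[atTop] fun n ↦ δ₀ n ^ i := by
  have h1 : (fun n ↦ δ₀ n ^ m) = fun n ↦ δ₀ n ^ i * δ₀ n ^ (m - i) := by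
    funext n; rw [← pow_add, Nat.add_sub_cancel' h.le]
  rw [h1]
  have h2 : (fun n ↦ δ₀ n ^ (m - i)) =o[atTop] fun _ ↦ (1 : ℝ) := by
    rw [isLittleO_one_iff]
    have := (tendsto_δ₀).pow (m - i)
    rwa [zero_pow (Nat.sub_ne_zero_of_lt h)] at this
  simpa using (isBigO_refl (fun n ↦ δ₀ n ^ i) atTop).mul_isLittleO h2

/-! ### Negligible polynomial families -/

/-- A family of real polynomials `p n` (in the variable `j`) is *negligible* (at scale `δ₀`) if
the degrees are bounded, every coefficient of `jⁱ` is `o(δ₀(n)ⁱ)`, and the constant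
coefficients vanish. [folklore] -/
def IsNegl (p : ℕ → ℝ[X]) : Prop :=
  (∃ D : ℕ, ∀ n, (p n).natDegree ≤ D) ∧
    (∀ i : ℕ, (fun n ↦ (p n).coeff i) =o[atTop] fun n ↦ δ₀ n ^ i) ∧ ∀ n, (p n).coeff 0 = 0

namespace IsNegl

variable {p q : ℕ → ℝ[X]}

/-- The zero family is negligible. [folklore] -/
theorem zero : IsNegl fun _ ↦ 0 :=
  ⟨⟨0, fun _ ↦ by simp⟩, fun i ↦ by simp, fun _ ↦ by simp⟩

/-- Negligible families are closed under addition. [folklore] -/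
theorem add (hp : IsNegl p) (hq : IsNegl q) : IsNegl fun n ↦ p n + q n := by
  obtain ⟨⟨D, hD⟩, hc, h0⟩ := hp
  obtain ⟨⟨D', hD'⟩, hc', h0'⟩ := hq
  refine ⟨⟨max D D', fun n ↦ (natDegree_add_le _ _).trans (max_le_max (hD n) (hD' n))⟩,
    fun i ↦ ?_, fun n ↦ by simp [h0 n, h0' n]⟩
  simpa [coeff_add] using (hc i).add (hc' i)

/-- Negligible families are closed under negation. [folklore] -/
theorem neg (hp : IsNegl p) : IsNegl fun n ↦ -p n := by
  obtain ⟨⟨D, hD⟩, hc, h0⟩ := hp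
  refine ⟨⟨D, fun n ↦ by rw [natDegree_neg]; exact hD n⟩, fun i ↦ ?_, fun n ↦ by simp [h0 n]⟩
  simpa [coeff_neg] using (hc i).neg_left

/-- Negligible families are closed under subtraction. [folklore] -/
theorem sub (hp : IsNegl p) (hq : IsNegl q) : IsNegl fun n ↦ p n - q n := by
  simpa [sub_eq_add_neg] using hp.add hq.neg

/-- Negligible families are closed under constant scalar multiplication. [folklore] -/
theorem const_smul (hp : IsNegl p) (c : ℝ) : IsNegl fun n ↦ c • p n := by
  obtain ⟨⟨D, hD⟩, hc, h0⟩ := hp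
  refine ⟨⟨D, fun n ↦ (natDegree_smul_le _ _).trans (hD n)⟩, fun i ↦ ?_, fun n ↦ by simp [h0 n]⟩
  simpa [coeff_smul] using (hc i).const_mul_left c

/-- Finite sums of negligible families are negligible. [folklore] -/
theorem sum {ι : Type*} (s : Finset ι) {P : ι → ℕ → ℝ[X]} (h : ∀ k ∈ s, IsNegl (P k)) :
    IsNegl fun n ↦ ∑ k ∈ s, P k n := by
  classical
  induction s using Finset.induction_on with
  | empty => simpa using zero
  | insert a s ha ih =>
    have := (h a (mem_insert_self a s)).add (ih fun k hk ↦ h k (mem_insert_of_mem hk))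
    simpa [sum_insert ha] using this

/-- Negligible families are closed under multiplication (Cauchy product of the coefficients:
`o(δ₀^a) o(δ₀^b) = o(δ₀^{a+b})`). [folklore] -/
theorem mul (hp : IsNegl p) (hq : IsNegl q) : IsNegl fun n ↦ p n * q n := by
  obtain ⟨⟨D, hD⟩, hc, h0⟩ := hp
  obtain ⟨⟨D', hD'⟩, hc', h0'⟩ := hq
  refine ⟨⟨D + D', fun n ↦ natDegree_mul_le.trans (add_le_add (hD n) (hD' n))⟩, fun i ↦ ?_,
    fun n ↦ by simp [mul_coeff_zero, h0 n]⟩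
  have : (fun n ↦ (p n * q n).coeff i) =
      fun n ↦ ∑ x ∈ antidiagonal i, (p n).coeff x.1 * (q n).coeff x.2 := by
    funext n; rw [coeff_mul]
  rw [this]
  refine IsLittleO.sum fun x hx ↦ ?_
  have hx' : x.1 + x.2 = i := mem_antidiagonal.1 hx
  have := (hc x.1).mul (hc' x.2)
  simpa [← pow_add, hx'] using this

/-- Positive powers of a negligible family are negligible. [folklore] -/
theorem pow (hp : IsNegl p) {r : ℕ} (hr : 1 ≤ r) : IsNegl fun n ↦ p n ^ r := by
  induction r with
  | zero => exact absurd hr (by norm_num)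
  | succ r ih =>
    rcases Nat.eq_zero_or_pos r with rfl | hr'
    · simpa using hp
    · simpa [pow_succ] using (ih hr').mul hp

/-- A fixed polynomial `q` with `q(0) = 0` and `deg q ≤ l`, times a sequence `a(n) = o(δ₀(n)^l)`,
is negligible. [folklore] -/
theorem smul_of_isLittleO {a : ℕ → ℝ} {l : ℕ} {q : ℝ[X]}
    (ha : a =o[atTop] fun n ↦ δ₀ n ^ l) (hq : q.natDegree ≤ l) (hq0 : q.coeff 0 = 0) :
    IsNegl fun n ↦ a n • q := by
  refine ⟨⟨l, fun n ↦ (natDegree_smul_le _ _).trans hq⟩, fun i ↦ ?_, fun n ↦ by simp [hq0]⟩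
  simp only [coeff_smul, smul_eq_mul]
  rcases le_or_gt i l with hi | hi
  · simpa [mul_comm] using (ha.trans_isBigO (isBigO_δ₀_pow_of_le hi)).const_mul_left (q.coeff i)
  · have : q.coeff i = 0 := coeff_eq_zero_of_natDegree_lt (lt_of_le_of_lt hq hi)
    simp [this]

/-- A fixed polynomial `q` with `q(0) = 0` and `deg q < m`, times a sequence `a(n) = O(δ₀(n)^m)`,
is negligible. [folklore] -/
theorem smul_of_isBigO {a : ℕ → ℝ} {m : ℕ} {q : ℝ[X]}
    (ha : a =O[atTop] fun n ↦ δ₀ n ^ m) (hq : q.natDegree < m) (hq0 : q.coeff 0 = 0) :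
    IsNegl fun n ↦ a n • q := by
  refine ⟨⟨m, fun n ↦ (natDegree_smul_le _ _).trans hq.le⟩, fun i ↦ ?_, fun n ↦ by simp [hq0]⟩
  simp only [coeff_smul, smul_eq_mul]
  rcases lt_or_ge i m with hi | hi
  · simpa [mul_comm] using (ha.trans_isLittleO (isLittleO_δ₀_pow_of_lt hi)).const_mul_left
      (q.coeff i)
  · have : q.coeff i = 0 := coeff_eq_zero_of_natDegree_lt (lt_of_lt_of_le hq hi)
    simp [this]

/-- Evaluation at a fixed point of a negligible family is `o(δ₀)`. [folklore] -/
theorem isLittleO_eval (hp : IsNegl p) (j : ℝ) :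
    (fun n ↦ (p n).eval j) =o[atTop] fun n ↦ δ₀ n := by
  obtain ⟨⟨D, hD⟩, hc, h0⟩ := hp
  have h1 : (fun n ↦ (p n).eval j) = fun n ↦ ∑ i ∈ range (D + 1), (p n).coeff i * j ^ i := by
    funext n; exact eval_eq_sum_range' (Nat.lt_succ_of_le (hD n)) j
  rw [h1]
  refine IsLittleO.sum fun i _ ↦ ?_
  rcases Nat.eq_zero_or_pos i with rfl | hi
  · simp only [h0, zero_mul]; exact isLittleO_zero _ _
  · have := ((hc i).trans_isBigO (isBigO_δ₀_pow_of_le (m := i) (i := 1) hi)).mul_isBigO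
      (isBigO_const_const (j ^ i) (one_ne_zero (α := ℝ)) atTop)
    simpa using this

/-- If in addition all coefficients of degree `≤ d` vanish, evaluation is `o(δ₀^{d+1})`.
[folklore] -/
theorem isLittleO_eval_of_coeff_eq_zero {D d : ℕ} (hD : ∀ n, (p n).natDegree ≤ D)
    (hc : ∀ i : ℕ, (fun n ↦ (p n).coeff i) =o[atTop] fun n ↦ δ₀ n ^ i)
    (hz : ∀ n, ∀ i ≤ d, (p n).coeff i = 0) (j : ℝ) :
    (fun n ↦ (p n).eval j) =o[atTop] fun n ↦ δ₀ n ^ (d + 1) := by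
  have h1 : (fun n ↦ (p n).eval j) = fun n ↦ ∑ i ∈ range (D + 1), (p n).coeff i * j ^ i := by
    funext n; exact eval_eq_sum_range' (Nat.lt_succ_of_le (hD n)) j
  rw [h1]
  refine IsLittleO.sum fun i _ ↦ ?_
  rcases le_or_gt i d with hi | hi
  · have : (fun n ↦ (p n).coeff i * j ^ i) = fun _ ↦ 0 := by
      funext n; rw [hz n i hi, zero_mul]
    rw [this]; exact isLittleO_zero _ _
  · have := ((hc i).trans_isBigO (isBigO_δ₀_pow_of_le (m := i) (i := d + 1) hi)).mul_isBigO
      (isBigO_const_const (j ^ i) (one_ne_zero (α := ℝ)) atTop)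
    simpa using this

/-- The truncation `∑_{1 ≤ i ≤ d} cᵢ(n) jⁱ` of a negligible family captures its value at `j` up to
`o(δ₀^d)`. [folklore] -/
theorem isLittleO_eval_sub_sum (hp : IsNegl p) (j : ℝ) (d : ℕ) :
    (fun n ↦ (p n).eval j - ∑ i ∈ Icc 1 d, (p n).coeff i * j ^ i) =o[atTop]
      fun n ↦ δ₀ n ^ d := by
  obtain ⟨⟨D, hD⟩, hc, h0⟩ := hp
  -- the tail family
  set T : ℕ → ℝ[X] := fun n ↦ p n - ∑ i ∈ Icc 1 d, C ((p n).coeff i) * X ^ i with hT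
  have hTeval : ∀ n, (T n).eval j = (p n).eval j - ∑ i ∈ Icc 1 d, (p n).coeff i * j ^ i := by
    intro n; simp [hT, eval_finsetSum]
  have hTcoeff : ∀ n i, (T n).coeff i = if i ∈ Icc 1 d then 0 else (p n).coeff i := by
    intro n i
    simp only [hT, coeff_sub, finsetSum_coeff, coeff_C_mul, coeff_X_pow, mul_ite, mul_one, mul_zero]
    rw [Finset.sum_ite_eq]
    split_ifs <;> ring
  have hTD : ∀ n, (T n).natDegree ≤ max D d := by
    intro n
    refine (natDegree_sub_le _ _).trans (max_le_max (hD n) ?_)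
    refine natDegree_sum_le_of_forall_le _ _ fun i hi ↦ ?_
    exact (natDegree_C_mul_X_pow_le _ _).trans (mem_Icc.1 hi).2
  have hTc : ∀ i, (fun n ↦ (T n).coeff i) =o[atTop] fun n ↦ δ₀ n ^ i := by
    intro i
    simp only [hTcoeff]
    split_ifs
    · exact isLittleO_zero _ _
    · exact hc i
  have hTz : ∀ n, ∀ i ≤ d, (T n).coeff i = 0 := by
    intro n i hi
    rw [hTcoeff]
    split_ifs with h
    · rfl
    · have : i = 0 := by
        simp only [mem_Icc, not_and, not_le] at h
        by_contra hne
        exact absurd (h (Nat.one_le_iff_ne_zero.2 hne)) (not_lt.2 hi)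
      rw [this, h0]
  have := isLittleO_eval_of_coeff_eq_zero hTD hTc hTz j
  simp only [hTeval] at this
  exact this.trans_isBigO (isBigO_δ₀_pow_of_le (Nat.le_succ d))

end IsNegl

/-! ### `log(1 + ε)` of a negligible family -/

/-- The polynomial family `L_R(E) = ∑_{i<R} (-1)^i E^{i+1}/(i+1)`, the order-`R` Taylor polynomial
of `log(1 + E)`. [folklore] -/
def logPoly (R : ℕ) (E : ℕ → ℝ[X]) (n : ℕ) : ℝ[X] :=
  ∑ i ∈ range R, ((-1 : ℝ) ^ i / (i + 1)) • E n ^ (i + 1)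

/-- The Taylor polynomial family `L_R(E)` of a negligible family `E` is negligible. [folklore] -/
theorem IsNegl.logPoly {E : ℕ → ℝ[X]} (hE : IsNegl E) (R : ℕ) : IsNegl (logPoly R E) :=
  IsNegl.sum _ fun i _ ↦ (hE.pow (Nat.succ_pos i)).const_smul _

/-- **`log(1 + ε)` expansion**: for a negligible family `E` and fixed `j`,
`log(1 + E_n(j)) = L_R(E)_n(j) + o(δ₀^{R+1})`. [folklore] -/
theorem isLittleO_log_one_add_sub_logPoly {E : ℕ → ℝ[X]} (hE : IsNegl E) (R : ℕ) (j : ℝ) :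
    (fun n ↦ Real.log (1 + (E n).eval j) - (logPoly R E n).eval j) =o[atTop]
      fun n ↦ δ₀ n ^ (R + 1) := by
  have hε := hE.isLittleO_eval j
  have hεR : (fun n ↦ ((E n).eval j) ^ (R + 1)) =o[atTop] fun n ↦ δ₀ n ^ (R + 1) :=
    hε.pow (Nat.succ_pos R)
  -- eventually |ε| ≤ 1/2
  have hsmall : ∀ᶠ n in atTop, |(E n).eval j| ≤ 1 / 2 := by
    have h1 := hε.def (c := 1 / 2) (by norm_num)
    filter_upwards [h1, eventually_δ₀_le_one] with n hn hδ
    rw [Real.norm_eq_abs, Real.norm_eq_abs, abs_of_nonneg (δ₀_nonneg n)] at hn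
    linarith [hn]
  refine IsBigO.trans_isLittleO ?_ hεR
  refine IsBigO.of_bound 2 ?_
  filter_upwards [hsmall] with n hn
  set ε := (E n).eval j with hεdef
  have hx : |(-ε)| < 1 := by rw [abs_neg]; linarith
  have key := Real.abs_log_sub_add_sum_range_le hx R
  have hL : (logPoly R E n).eval j = -∑ i ∈ range R, (-ε) ^ (i + 1) / (i + 1) := by
    rw [logPoly, eval_finsetSum, ← sum_neg_distrib]
    refine sum_congr rfl fun i _ ↦ ?_
    rw [eval_smul, eval_pow, smul_eq_mul, ← hεdef, neg_pow ε (i + 1), pow_succ (-1 : ℝ) i]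
    ring
  rw [Real.norm_eq_abs, Real.norm_eq_abs, hL, sub_neg_eq_add, show (1 : ℝ) + ε = 1 - -ε by ring,
    add_comm]
  refine key.trans ?_
  rw [abs_neg, abs_pow, div_le_iff₀ (by linarith)]
  have : 0 ≤ |ε| ^ (R + 1) := pow_nonneg (abs_nonneg _) _
  nlinarith

/-! ### Faulhaber polynomials `∑_{k<j} k^r` -/

/-- The Faulhaber polynomial `F_r` with `F_r(j) = ∑_{k<j} k^r` (Bernoulli's formula,
Mathlib `Finset.sum_range_pow`). [folklore] -/
def faulhaber (r : ℕ) : ℝ[X] :=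
  ∑ i ∈ range (r + 1), C ((bernoulli i : ℝ) * ((r + 1).choose i : ℝ) / (r + 1)) * X ^ (r + 1 - i)

/-- `F_r(j) = ∑_{k<j} k^r` for natural `j` (Faulhaber / Bernoulli). [folklore] -/
theorem faulhaber_eval (r j : ℕ) : (faulhaber r).eval (j : ℝ) = ∑ k ∈ range j, (k : ℝ) ^ r := by
  have h := _root_.sum_range_pow j r
  have h' := congrArg (fun q : ℚ ↦ (q : ℝ)) h
  simp only [Rat.cast_sum, Rat.cast_pow, Rat.cast_natCast, Rat.cast_div, Rat.cast_mul,
    Rat.cast_add, Rat.cast_one] at h'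
  rw [h', faulhaber, eval_finsetSum]
  refine sum_congr rfl fun i _ ↦ ?_
  rw [eval_mul, eval_C, eval_pow, eval_X]
  ring

/-- `deg F_r ≤ r + 1`. [folklore] -/
theorem natDegree_faulhaber_le (r : ℕ) : (faulhaber r).natDegree ≤ r + 1 := by
  refine natDegree_sum_le_of_forall_le _ _ fun i _ ↦ ?_
  exact (natDegree_C_mul_X_pow_le _ _).trans (Nat.sub_le _ _)

/-- `F_r(0) = 0`: the Faulhaber polynomial has no constant term. [folklore] -/
theorem faulhaber_coeff_zero (r : ℕ) : (faulhaber r).coeff 0 = 0 := by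
  rw [coeff_zero_eq_eval_zero, show (0 : ℝ) = ((0 : ℕ) : ℝ) by simp, faulhaber_eval]
  simp

/-! ### The binomial-coefficient polynomials `C(2j, l)` -/

/-- The polynomial `q_l` with `q_l(j) = C(2j, l)`: `q_l = (2X)(2X-1)⋯(2X-l+1)/l!`. [folklore] -/
def choosePoly (l : ℕ) : ℝ[X] := (l ! : ℝ)⁻¹ • (descPochhammer ℝ l).comp (C 2 * X)

/-- `q_l(j) = C(2j, l)` for natural `j`. [folklore] -/
theorem choosePoly_eval (l j : ℕ) : (choosePoly l).eval (j : ℝ) = ((2 * j).choose l : ℝ) := by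
  rw [choosePoly, eval_smul, eval_comp, eval_mul, eval_C, eval_X, smul_eq_mul,
    show (2 : ℝ) * j = ((2 * j : ℕ) : ℝ) by push_cast; ring, descPochhammer_eval_eq_descFactorial,
    Nat.descFactorial_eq_factorial_mul_choose]
  have : (l ! : ℝ) ≠ 0 := by exact_mod_cast Nat.factorial_ne_zero l
  push_cast
  field_simp

/-- `deg q_l ≤ l`. [folklore] -/
theorem natDegree_choosePoly_le (l : ℕ) : (choosePoly l).natDegree ≤ l := by
  rw [choosePoly]
  refine (natDegree_smul_le _ _).trans (natDegree_comp_le.trans ?_)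
  have h1 : (descPochhammer ℝ l).natDegree ≤ l := (descPochhammer_natDegree (R := ℝ) l).le
  have h2 : (C (2:ℝ) * X).natDegree ≤ 1 := (natDegree_C_mul_le _ _).trans natDegree_X_le
  calc (descPochhammer ℝ l).natDegree * (C (2:ℝ) * X).natDegree ≤ l * 1 :=
        Nat.mul_le_mul h1 h2
    _ = l := mul_one l

/-- `q_l(0) = 0` for `l ≥ 1`. [folklore] -/
theorem choosePoly_coeff_zero {l : ℕ} (hl : 1 ≤ l) : (choosePoly l).coeff 0 = 0 := by
  rw [coeff_zero_eq_eval_zero, show (0 : ℝ) = ((0 : ℕ) : ℝ) by simp, choosePoly_eval, mul_zero,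
    Nat.choose_eq_zero_of_lt (by omega), Nat.cast_zero]

/-! ### The sequence `y(n) = 1/(n + 1/2)` -/

/-- `y(n) = 1/(n + 1/2)`. [folklore] -/
def yseq (n : ℕ) : ℝ := 1 / ((n : ℝ) + 1 / 2)

/-- `y(n) > 0`. [folklore] -/
theorem yseq_pos (n : ℕ) : 0 < yseq n := by unfold yseq; positivity

/-- `y(n) ≤ 2 δ₀(n)² = 1/n` for `n ≥ 1`. [folklore] -/
theorem yseq_le {n : ℕ} (hn : 1 ≤ n) : yseq n ≤ 2 * δ₀ n ^ 2 := by
  rw [δ₀_sq hn, yseq]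
  have : (1:ℝ) ≤ n := by exact_mod_cast hn
  rw [div_le_iff₀ (by positivity), mul_comm]
  field_simp
  linarith

/-- `δ₀(n)²/2 ≤ y(n)/2`, i.e. `1/(4n) ≤ 1/(2n+1)`, for `n ≥ 1`. [folklore] -/
theorem half_δ₀_sq_le {n : ℕ} (hn : 1 ≤ n) : δ₀ n ^ 2 / 2 ≤ yseq n / 2 := by
  rw [δ₀_sq hn, yseq]
  have : (1:ℝ) ≤ n := by exact_mod_cast hn
  apply div_le_div_of_nonneg_right _ (by norm_num)
  exact one_div_le_one_div_of_le (by positivity) (by linarith)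

/-- `y(n) → 0`. [folklore] -/
theorem tendsto_yseq : Tendsto yseq atTop (𝓝 0) := by
  have h : ∀ᶠ n in atTop, |yseq n| ≤ 2 * δ₀ n ^ 2 := by
    filter_upwards [eventually_ge_atTop 1] with n hn
    rw [abs_of_pos (yseq_pos n)]; exact yseq_le hn
  have h2 : Tendsto (fun n ↦ 2 * δ₀ n ^ 2) atTop (𝓝 0) := by
    simpa using (tendsto_δ₀.pow 2).const_mul 2
  exact squeeze_zero_norm' h h2

/-- `y(n)^m = O(δ₀(n)^{2m})`. [folklore] -/
theorem isBigO_yseq_pow (m : ℕ) : (fun n ↦ yseq n ^ m) =O[atTop] fun n ↦ δ₀ n ^ (2 * m) := by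
  have h1 : yseq =O[atTop] fun n ↦ δ₀ n ^ 2 := by
    refine IsBigO.of_bound 2 ?_
    filter_upwards [eventually_ge_atTop 1] with n hn
    rw [Real.norm_eq_abs, Real.norm_eq_abs, abs_of_pos (yseq_pos n),
      abs_of_nonneg (pow_nonneg (δ₀_nonneg n) 2)]
    exact yseq_le hn
  simpa [← pow_mul] using h1.pow m

/-! ### The polynomial families `E`, `W`, `Q` -/

/-- `E_n = ∑_{2 ≤ l ≤ 2d} m_l(2n) q_l`, so that `E_n(j) = ∑_{l ≥ 2} C(2j, l) m_l(2n)`. [folklore] -/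
def Epoly (d n : ℕ) : ℝ[X] := ∑ l ∈ Icc 2 (2 * d), (xiCM (2 * n) l) • choosePoly l

/-- `m_l(2n) = o(δ₀(n)^l)` for `l ≥ 1` (the analytic input `isLittleO_xiCM` along even indices).
[cite: GORZPNAS2019, §5.1 (role of Thm. 7)] -/
theorem isLittleO_xiCM_two_mul {l : ℕ} (hl : 1 ≤ l) :
    (fun n : ℕ ↦ xiCM (2 * n) l) =o[atTop] fun n ↦ δ₀ n ^ l := by
  have h := (isLittleO_xiCM hl).comp_tendsto
    (tendsto_id.const_mul_atTop' (by norm_num : 0 < 2) : Tendsto (fun n : ℕ ↦ 2 * n) atTop atTop)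
  refine h.congr' (Eventually.of_forall fun n ↦ rfl) (Eventually.of_forall fun n ↦ ?_)
  simp [Function.comp, δ₀]

/-- `E` is a negligible family. [folklore] -/
theorem isNegl_Epoly (d : ℕ) : IsNegl (Epoly d) := by
  refine IsNegl.sum _ fun l hl ↦ ?_
  have hl2 : 2 ≤ l := (mem_Icc.1 hl).1
  exact IsNegl.smul_of_isLittleO (isLittleO_xiCM_two_mul (by omega))
    (natDegree_choosePoly_le l) (choosePoly_coeff_zero (by omega))

/-- `W_n = ∑_{1 ≤ i < R} (-1)^i y^{i+1}/(i+1) F_{i+1}`. [folklore] -/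
def Wpoly (R n : ℕ) : ℝ[X] :=
  ∑ i ∈ Ico 1 R, ((-1 : ℝ) ^ i * yseq n ^ (i + 1) / (i + 1)) • faulhaber (i + 1)

/-- `W` is a negligible family (`y^{i+1} F_{i+1}` has degree `i + 2 < 2i + 2` for `i ≥ 1`).
[folklore] -/
theorem isNegl_Wpoly (R : ℕ) : IsNegl (Wpoly R) := by
  refine IsNegl.sum _ fun i hi ↦ ?_
  have hi1 : 1 ≤ i := (mem_Ico.1 hi).1
  refine IsNegl.smul_of_isBigO (m := 2 * (i + 1)) ?_ ?_ (faulhaber_coeff_zero _)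
  · have h := (isBigO_yseq_pow (i + 1)).const_mul_left ((-1 : ℝ) ^ i / (i + 1))
    refine (IsBigO.of_bound' (Eventually.of_forall fun n ↦ le_of_eq ?_)).trans h
    simp only [Real.norm_eq_abs]; congr 1; ring
  · exact lt_of_le_of_lt (natDegree_faulhaber_le _) (by omega)

/-- `Q_n = L_d(E)_n - W_n`, the negligible part of the expansion. [folklore] -/
def Qpoly (d n : ℕ) : ℝ[X] := logPoly d (Epoly d) n - Wpoly d n

/-- `Q` is a negligible family. [folklore] -/
theorem isNegl_Qpoly (d : ℕ) : IsNegl (Qpoly d) :=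
  ((isNegl_Epoly d).logPoly d).sub (isNegl_Wpoly d)

/-! ### Step A: the exact decomposition of `log γ(n+j) - log γ(n)` -/

/-- The ratio of consecutive GORZ coefficients in terms of moments: `γ(m+1) (m + 1/2) M_{2m} = γ(m)
M_{2m+2}` (from `γ(m) = 64·4^m m!/(2m)! M_{2m}`). [cite: GORZPNAS2019, eq. (1)] -/
theorem xiTaylorCoeff_succ_mul (m : ℕ) :
    xiTaylorCoeff (m + 1) * (((m : ℝ) + 1 / 2) * xiMoment (2 * m)) =
      xiTaylorCoeff m * xiMoment (2 * m + 2) := by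
  rw [xiTaylorCoeff_eq_xiMoment, xiTaylorCoeff_eq_xiMoment,
    show 2 * (m + 1) = 2 * m + 1 + 1 by ring, Nat.factorial_succ (2 * m + 1),
    Nat.factorial_succ (2 * m), Nat.factorial_succ m]
  have h1 : ((2 * m)! : ℝ) ≠ 0 := by exact_mod_cast Nat.factorial_ne_zero _
  have h2 : ((m)! : ℝ) ≠ 0 := by exact_mod_cast Nat.factorial_ne_zero _
  push_cast
  field_simp
  ring

/-- `log γ(m+1) - log γ(m) = -log(m + 1/2) + log M_{2m+2} - log M_{2m}`. [cite: GORZPNAS2019, eq.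
(1)] -/
theorem log_xiTaylorCoeff_succ (m : ℕ) :
    Real.log (xiTaylorCoeff (m + 1)) - Real.log (xiTaylorCoeff m) =
      -Real.log ((m : ℝ) + 1 / 2) +
        (Real.log (xiMoment (2 * m + 2)) - Real.log (xiMoment (2 * m))) := by
  have h := xiTaylorCoeff_succ_mul m
  have h1 := xiTaylorCoeff_pos_holds (m + 1)
  have h2 := xiTaylorCoeff_pos_holds m
  have h3 := xiMoment_pos (2 * m)
  have h4 := xiMoment_pos (2 * m + 2)
  have h5 : (0 : ℝ) < m + 1 / 2 := by positivity
  have := congrArg Real.log h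
  rw [Real.log_mul h1.ne' (by positivity), Real.log_mul h5.ne' h3.ne', Real.log_mul h2.ne' h4.ne']
    at this
  linarith

/-- **Exact decomposition**: `log γ(n+j) - log γ(n) = -∑_{k<j} log(n + k + 1/2) + log M_{2n+2j} -
log M_{2n}`. [cite: GORZPNAS2019, eq. (1)] -/
theorem log_xiTaylorCoeff_add (n j : ℕ) :
    Real.log (xiTaylorCoeff (n + j)) - Real.log (xiTaylorCoeff n) =
      -∑ k ∈ range j, Real.log ((n : ℝ) + k + 1 / 2) +
        (Real.log (xiMoment (2 * n + 2 * j)) - Real.log (xiMoment (2 * n))) := by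
  induction j with
  | zero => simp
  | succ j ih =>
    have hs := log_xiTaylorCoeff_succ (n + j)
    rw [sum_range_succ, show n + (j + 1) = n + j + 1 by ring,
      show 2 * n + 2 * (j + 1) = 2 * (n + j) + 2 by ring]
    rw [show 2 * n + 2 * j = 2 * (n + j) by ring] at ih
    push_cast at hs ⊢
    linarith

/-! ### Step B: the moment part -/

/-- `∑_{l ≤ 2j} C(2j,l) m_l(2n) = 1 + E_n(j)` for `j ≤ d` (`m_0 = 1`, `m_1 = 0`). [folklore] -/
theorem sum_choose_xiCM_eq {d j : ℕ} (hd : 1 ≤ d) (hj : j ≤ d) (n : ℕ) :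
    ∑ l ∈ range (2 * j + 1), ((2 * j).choose l : ℝ) * xiCM (2 * n) l =
      1 + (Epoly d n).eval (j : ℝ) := by
  -- extend the sum to range (2d + 1)
  have hext : ∑ l ∈ range (2 * j + 1), ((2 * j).choose l : ℝ) * xiCM (2 * n) l =
      ∑ l ∈ range (2 * d + 1), ((2 * j).choose l : ℝ) * xiCM (2 * n) l := by
    refine sum_subset (range_mono (by omega)) fun l hl hl' ↦ ?_
    simp only [mem_range, not_lt] at hl hl'
    rw [Nat.choose_eq_zero_of_lt (by omega), Nat.cast_zero, zero_mul]
  rw [hext, Finset.range_eq_Ico, ← Finset.sum_Ico_consecutive _ (by omega : 0 ≤ 2)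
    (by omega : 2 ≤ 2 * d + 1)]
  have h01 : ∑ l ∈ Ico 0 2, ((2 * j).choose l : ℝ) * xiCM (2 * n) l = 1 := by
    rw [show Ico 0 2 = {0, 1} by decide, sum_pair (by norm_num), xiCM_zero, xiCM_one]; simp
  rw [h01]
  congr 1
  rw [Epoly, eval_finsetSum, show Ico 2 (2 * d + 1) = Icc 2 (2 * d) from rfl]
  refine sum_congr rfl fun l _ ↦ ?_
  rw [eval_smul, choosePoly_eval, smul_eq_mul, mul_comm]

/-- `log M_{2n+2j} - log M_{2n} = 2j log ū_{2n} + log(1 + E_n(j))` for `j ≤ d`. [folklore] -/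
theorem log_xiMoment_ratio {d j : ℕ} (hd : 1 ≤ d) (hj : j ≤ d) (n : ℕ) :
    Real.log (xiMoment (2 * n + 2 * j)) - Real.log (xiMoment (2 * n)) =
      2 * j * Real.log (xiMean (2 * n)) + Real.log (1 + (Epoly d n).eval (j : ℝ)) := by
  have hM := xiMoment_pos (2 * n)
  have hMj := xiMoment_pos (2 * n + 2 * j)
  have hū := xiMean_pos (2 * n)
  have key := xiMoment_add_div (2 * n) (2 * j)
  rw [sum_choose_xiCM_eq hd hj n] at key
  have hpos : 0 < 1 + (Epoly d n).eval (j : ℝ) := by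
    have : 0 < xiMoment (2 * n + 2 * j) / xiMoment (2 * n) := div_pos hMj hM
    rw [key] at this
    exact pos_of_mul_pos_right this (pow_nonneg hū.le _)  -- (pos_of_mul_pos...)
  rw [← Real.log_div hMj.ne' hM.ne', key, Real.log_mul (pow_pos hū _).ne' hpos.ne', Real.log_pow]
  push_cast
  ring

/-! ### Step C: the factorial part -/

/-- `∑_{k<j} log(n + k + 1/2) = j log(n + 1/2) + ∑_{k<j} log(1 + k y(n))`. [folklore] -/
theorem sum_log_eq (n j : ℕ) :
    ∑ k ∈ range j, Real.log ((n : ℝ) + k + 1 / 2) =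
      j * Real.log ((n : ℝ) + 1 / 2) + ∑ k ∈ range j, Real.log (1 + k * yseq n) := by
  have hv : (0 : ℝ) < n + 1 / 2 := by positivity
  have : ∀ k ∈ range j, Real.log ((n : ℝ) + k + 1 / 2) =
      Real.log ((n : ℝ) + 1 / 2) + Real.log (1 + k * yseq n) := by
    intro k _
    rw [← Real.log_mul hv.ne' (by have := yseq_pos n; positivity)]
    congr 1
    rw [yseq]; field_simp; ring
  rw [sum_congr rfl this, sum_add_distrib, sum_const, card_range, nsmul_eq_mul]

/-- `2 ∑_{k<j} k = j² - j` (Gauss). [folklore] -/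
theorem two_mul_sum_range_cast (j : ℕ) : 2 * ∑ k ∈ range j, (k : ℝ) = (j : ℝ) ^ 2 - j := by
  induction j with
  | zero => simp
  | succ j ih => rw [sum_range_succ, mul_add, ih]; push_cast; ring

/-- Summing the Taylor polynomials of `log(1 + k y)` over `k < j`: `∑_{k<j} ∑_{i<R} (-1)^i
(ky)^{i+1}/(i+1) = (y/2)(j² - j) + W_n(j)`. [folklore] -/
theorem sum_taylor_eq (R n j : ℕ) (hR : 1 ≤ R) :
    ∑ k ∈ range j, ∑ i ∈ range R, (-1 : ℝ) ^ i * ((k : ℝ) * yseq n) ^ (i + 1) / (i + 1) =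
      yseq n / 2 * ((j : ℝ) ^ 2 - j) + (Wpoly R n).eval (j : ℝ) := by
  rw [sum_comm]
  rw [Finset.range_eq_Ico, ← Finset.sum_Ico_consecutive _ (Nat.zero_le 1) hR,
    show Ico 0 1 = {0} by decide, sum_singleton]
  congr 1
  · -- i = 0 term
    simp only [pow_zero, one_mul, zero_add, pow_one, Nat.cast_zero, div_one]
    rw [← two_mul_sum_range_cast]
    simp only [mul_sum]
    refine sum_congr rfl fun k _ ↦ ?_; ring
  · rw [Wpoly, eval_finsetSum]
    refine sum_congr rfl fun i _ ↦ ?_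
    rw [eval_smul, smul_eq_mul, faulhaber_eval]
    simp only [mul_sum]
    refine sum_congr rfl fun k _ ↦ ?_
    rw [mul_pow]; ring

/-- `log(1 + k y(n)) = ∑_{i<R} (-1)^i (k y(n))^{i+1}/(i+1) + O(y(n)^{R+1})`, and `O(y^{R+1}) =
o(δ₀^{2R+1})`. [folklore] -/
theorem isLittleO_log_one_add_mul_yseq (k R : ℕ) :
    (fun n ↦ Real.log (1 + k * yseq n) -
        ∑ i ∈ range R, (-1 : ℝ) ^ i * ((k : ℝ) * yseq n) ^ (i + 1) / (i + 1)) =o[atTop]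
      fun n ↦ δ₀ n ^ (2 * R + 1) := by
  -- the error is ≤ 2 (k y)^{R+1} = O(δ₀^{2R+2})
  have hsmall : ∀ᶠ n in atTop, (k : ℝ) * yseq n ≤ 1 / 2 := by
    have := (tendsto_yseq.const_mul (k : ℝ)); rw [mul_zero] at this
    exact (this.eventually (ge_mem_nhds (by norm_num : (0:ℝ) < 1 / 2))).mono fun n hn ↦ hn
  have hbig : (fun n ↦ Real.log (1 + k * yseq n) -
      ∑ i ∈ range R, (-1 : ℝ) ^ i * ((k : ℝ) * yseq n) ^ (i + 1) / (i + 1)) =O[atTop]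
      fun n ↦ yseq n ^ (R + 1) := by
    refine IsBigO.of_bound (2 * (k : ℝ) ^ (R + 1)) ?_
    filter_upwards [hsmall] with n hn
    set x : ℝ := -(k * yseq n) with hx
    have hkx : 0 ≤ (k : ℝ) * yseq n := by have := yseq_pos n; positivity
    have habs : |x| = k * yseq n := by rw [hx, abs_neg, abs_of_nonneg hkx]
    have hx1 : |x| < 1 := by rw [habs]; linarith
    have key := Real.abs_log_sub_add_sum_range_le hx1 R
    have hsum : ∑ i ∈ range R, (-1 : ℝ) ^ i * ((k : ℝ) * yseq n) ^ (i + 1) / (i + 1) =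
        -∑ i ∈ range R, x ^ (i + 1) / (i + 1) := by
      rw [← sum_neg_distrib]; refine sum_congr rfl fun i _ ↦ ?_
      rw [hx, neg_pow ((k : ℝ) * yseq n) (i + 1), pow_succ (-1 : ℝ) i]; ring
    rw [Real.norm_eq_abs, Real.norm_eq_abs, hsum, sub_neg_eq_add,
      show (1 : ℝ) + k * yseq n = 1 - x by rw [hx]; ring, add_comm,
      abs_of_pos (pow_pos (yseq_pos n) _)]
    refine key.trans ?_
    rw [div_le_iff₀ (by linarith), habs, mul_pow]
    have h1 : 0 ≤ yseq n ^ (R + 1) := pow_nonneg (yseq_pos n).le _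
    have h2 : 0 ≤ (k : ℝ) ^ (R + 1) := pow_nonneg (Nat.cast_nonneg k) _
    nlinarith [mul_nonneg h2 h1]
  refine hbig.trans_isLittleO ((isBigO_yseq_pow (R + 1)).trans_isLittleO ?_)
  exact isLittleO_δ₀_pow_of_lt (by omega)

/-- The total Taylor error of the factorial part, `o(δ₀^d)`. [folklore] -/
theorem isLittleO_sum_log_sub {d : ℕ} (hd : 1 ≤ d) (j : ℕ) :
    (fun n ↦ ∑ k ∈ range j, Real.log (1 + k * yseq n) -
        (yseq n / 2 * ((j : ℝ) ^ 2 - j) + (Wpoly d n).eval (j : ℝ))) =o[atTop]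
      fun n ↦ δ₀ n ^ d := by
  have hs : ∀ n, yseq n / 2 * ((j : ℝ) ^ 2 - j) + (Wpoly d n).eval (j : ℝ) =
      ∑ k ∈ range j, ∑ i ∈ range d, (-1 : ℝ) ^ i * ((k : ℝ) * yseq n) ^ (i + 1) / (i + 1) :=
    fun n ↦ (sum_taylor_eq d n j hd).symm
  simp only [hs, ← sum_sub_distrib]
  refine IsLittleO.sum fun k _ ↦ ?_
  exact (isLittleO_log_one_add_mul_yseq k d).trans_isBigO (isBigO_δ₀_pow_of_le (by omega))

/-! ### Step D: the expansion with a negligible polynomial part -/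

/-- The main linear coefficient `A₀(n) = -log(n + 1/2) + y(n)/2 + 2 log ū_{2n}`. [folklore] -/
def Aseq0 (n : ℕ) : ℝ := -Real.log ((n : ℝ) + 1 / 2) + yseq n / 2 + 2 * Real.log (xiMean (2 * n))

/-- `log(γ(n+j)/γ(n)) = A₀(n) j - (y(n)/2) j² + Q_n(j) + o(δ₀^d)` for `j ≤ d`. [folklore] -/
theorem logRatio_sub_isLittleO {d : ℕ} (hd : 1 ≤ d) {j : ℕ} (hj : j ≤ d) :
    (fun n ↦ Real.log (xiTaylorCoeff (n + j) / xiTaylorCoeff n) -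
        (Aseq0 n * j - yseq n / 2 * (j : ℝ) ^ 2 + (Qpoly d n).eval (j : ℝ))) =o[atTop]
      fun n ↦ δ₀ n ^ d := by
  have h1 := isLittleO_log_one_add_sub_logPoly (isNegl_Epoly d) d (j : ℝ)
  have h2 := isLittleO_sum_log_sub hd j
  have hident : ∀ n, Real.log (xiTaylorCoeff (n + j) / xiTaylorCoeff n) -
      (Aseq0 n * j - yseq n / 2 * (j : ℝ) ^ 2 + (Qpoly d n).eval (j : ℝ)) =
      (Real.log (1 + (Epoly d n).eval (j : ℝ)) - (logPoly d (Epoly d) n).eval (j : ℝ)) -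
      (∑ k ∈ range j, Real.log (1 + k * yseq n) -
        (yseq n / 2 * ((j : ℝ) ^ 2 - j) + (Wpoly d n).eval (j : ℝ))) := by
    intro n
    rw [Real.log_div (xiTaylorCoeff_pos_holds _).ne' (xiTaylorCoeff_pos_holds _).ne',
      log_xiTaylorCoeff_add, log_xiMoment_ratio hd hj, sum_log_eq, Qpoly, eval_sub, Aseq0]
    ring
  simp only [hident]
  exact (h1.trans_isBigO (isBigO_δ₀_pow_of_le (Nat.le_succ d))).sub h2

/-! ### Step E: extraction of `A`, `δ`, `g` and the expansion (15) -/

/-- The coefficients `c_i(n)` of the negligible part `Q_n`. [folklore] -/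
def cQ (d i n : ℕ) : ℝ := (Qpoly d n).coeff i

/-- `c_i(n) = o(δ₀(n)^i)`. [folklore] -/
theorem isLittleO_cQ (d i : ℕ) : (fun n ↦ cQ d i n) =o[atTop] fun n ↦ δ₀ n ^ i :=
  (isNegl_Qpoly d).2.1 i

/-- `A(n) = A₀(n) + c₁(n)`. [folklore] -/
def Aseq (d n : ℕ) : ℝ := Aseq0 n + cQ d 1 n

/-- `δ(n) = √(y(n)/2 - c₂(n))` (so `δ(n)² ∼ 1/(2n)`). [folklore] -/
def δseq (d n : ℕ) : ℝ := Real.sqrt (yseq n / 2 - cQ d 2 n)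

/-- `gᵢ(n) = cᵢ(n)` for `i ≥ 3`. [folklore] -/
def gseq (d : ℕ) (i n : ℕ) : ℝ := cQ d i n

/-- Eventually `y(n)/2 - c₂(n) ≥ δ₀(n)²/4 > 0`. [folklore] -/
theorem eventually_radicand (d : ℕ) : ∀ᶠ n in atTop, δ₀ n ^ 2 / 4 ≤ yseq n / 2 - cQ d 2 n := by
  have h := (isLittleO_cQ d 2).def (c := 1 / 4) (by norm_num)
  filter_upwards [h, eventually_ge_atTop 1] with n hn hn1
  rw [Real.norm_eq_abs, Real.norm_eq_abs, abs_of_nonneg (pow_nonneg (δ₀_nonneg n) 2)] at hn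
  have h1 := half_δ₀_sq_le hn1
  have h2 := (abs_le.1 hn).2
  linarith

/-- Eventually `δ(n)² = y(n)/2 - c₂(n)`. [folklore] -/
theorem eventually_δseq_sq (d : ℕ) : ∀ᶠ n in atTop, δseq d n ^ 2 = yseq n / 2 - cQ d 2 n := by
  filter_upwards [eventually_radicand d] with n hn
  exact Real.sq_sqrt (le_trans (by positivity) hn)

/-- Eventually `δ₀(n) ≤ 2 δ(n)`. [folklore] -/
theorem eventually_δ₀_le_two_mul_δseq (d : ℕ) : ∀ᶠ n in atTop, δ₀ n ≤ 2 * δseq d n := by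
  filter_upwards [eventually_radicand d] with n hn
  have h : (δ₀ n / 2) ^ 2 ≤ yseq n / 2 - cQ d 2 n := by
    rw [div_pow]; norm_num; linarith
  calc δ₀ n = 2 * Real.sqrt ((δ₀ n / 2) ^ 2) := by
        rw [Real.sqrt_sq (by have := δ₀_nonneg n; positivity)]; ring
    _ ≤ 2 * δseq d n := by
        unfold δseq
        exact mul_le_mul_of_nonneg_left (Real.sqrt_le_sqrt h) (by norm_num)

/-- Eventually `δ(n) > 0`. [folklore] -/
theorem eventually_δseq_pos (d : ℕ) : ∀ᶠ n in atTop, 0 < δseq d n := by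
  filter_upwards [eventually_δ₀_le_two_mul_δseq d, eventually_δ₀_pos] with n h1 h2
  linarith

/-- `δ(n) → 0`. [folklore] -/
theorem tendsto_δseq (d : ℕ) : Tendsto (δseq d) atTop (𝓝 0) := by
  have hc : Tendsto (cQ d 2) atTop (𝓝 0) :=
    (isLittleO_cQ d 2).trans_tendsto (by simpa using tendsto_δ₀.pow 2)
  have h1 : Tendsto (fun n ↦ yseq n / 2 - cQ d 2 n) atTop (𝓝 0) := by
    simpa using (tendsto_yseq.div_const 2).sub hc
  have h2 := h1.sqrt
  rw [Real.sqrt_zero] at h2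
  exact h2

/-- `δ₀(n)^i = O(δ(n)^i)`. [folklore] -/
theorem isBigO_δ₀_pow_δseq_pow (d i : ℕ) :
    (fun n ↦ δ₀ n ^ i) =O[atTop] fun n ↦ δseq d n ^ i := by
  refine IsBigO.of_bound (2 ^ i) ?_
  filter_upwards [eventually_δ₀_le_two_mul_δseq d, eventually_δseq_pos d] with n h1 h2
  rw [Real.norm_eq_abs, Real.norm_eq_abs, abs_of_nonneg (pow_nonneg (δ₀_nonneg n) i),
    abs_of_nonneg (pow_nonneg h2.le i), ← mul_pow]
  exact pow_le_pow_left₀ (δ₀_nonneg n) h1 i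

/-- **GORZ §5.1 eq. (15) for `γ = xiTaylorCoeff`, degrees `d ≥ 2`.**
[cite: GORZPNAS2019, §5.1 eq. (15)] -/
theorem xiTaylorCoeff_logRatio_of_two_le {d : ℕ} (hd : 2 ≤ d) :
    ∃ (A δ : ℕ → ℝ) (g : ℕ → ℕ → ℝ),
    (∀ᶠ n in atTop, 0 < δ n) ∧ Tendsto δ atTop (𝓝 0) ∧
    (∀ i, 3 ≤ i → i ≤ d → (g i) =o[atTop] fun n ↦ δ n ^ i) ∧
    ∀ j : ℕ, j ≤ d → (fun n ↦ Real.log (xiTaylorCoeff (n + j) / xiTaylorCoeff n) -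
        (A n * j - δ n ^ 2 * (j : ℝ) ^ 2 + ∑ i ∈ Icc 3 d, g i n * (j : ℝ) ^ i)) =o[atTop]
        fun n ↦ δ n ^ d := by
  refine ⟨Aseq d, δseq d, gseq d, eventually_δseq_pos d, tendsto_δseq d, fun i _ _ ↦
    (isLittleO_cQ d i).trans_isBigO (isBigO_δ₀_pow_δseq_pow d i), fun j hj ↦ ?_⟩
  have hd1 : 1 ≤ d := by omega
  have hmain := logRatio_sub_isLittleO hd1 hj
  have htail := (isNegl_Qpoly d).isLittleO_eval_sub_sum (j : ℝ) d
  have hev : ∀ᶠ n in atTop,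
      (Real.log (xiTaylorCoeff (n + j) / xiTaylorCoeff n) -
        (Aseq0 n * j - yseq n / 2 * (j : ℝ) ^ 2 + (Qpoly d n).eval (j : ℝ))) +
      ((Qpoly d n).eval (j : ℝ) - ∑ i ∈ Icc 1 d, (Qpoly d n).coeff i * (j : ℝ) ^ i) =
      Real.log (xiTaylorCoeff (n + j) / xiTaylorCoeff n) -
      (Aseq d n * j - δseq d n ^ 2 * (j : ℝ) ^ 2 + ∑ i ∈ Icc 3 d, gseq d i n * (j : ℝ) ^ i) := by
    filter_upwards [eventually_δseq_sq d] with n hn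
    have hsplit : ∑ i ∈ Icc 1 d, (Qpoly d n).coeff i * (j : ℝ) ^ i =
        cQ d 1 n * j + cQ d 2 n * (j : ℝ) ^ 2 + ∑ i ∈ Icc 3 d, gseq d i n * (j : ℝ) ^ i := by
      rw [← Finset.insert_Icc_add_one_left_eq_Icc (by omega : 1 ≤ d), sum_insert (by simp),
        show (1 : ℕ) + 1 = 2 from rfl,
        ← Finset.insert_Icc_add_one_left_eq_Icc (by omega : 2 ≤ d), sum_insert (by simp)]
      simp only [cQ, gseq, pow_one]
      ring
    rw [hsplit, hn, Aseq]
    ring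
  exact ((hmain.add htail).congr' hev (Eventually.of_forall fun _ ↦ rfl)).trans_isBigO
    (isBigO_δ₀_pow_δseq_pow d d)

/-- **GORZ, PNAS 116 (2019), §5.1 eq. (15) for the Taylor coefficients `γ(n)` of `Ξ`** — the
statement of the named fact `Literature.NumberTheory.LFunctions.xiTaylorCoeff_logRatio` (`JensenHermite.lean`), PROVED:
for every `d ≥ 1` there are `A(n)`, `δ(n) → 0⁺`, `gᵢ(n) = o(δ(n)ⁱ)` (`3 ≤ i ≤ d`) with
`log(γ(n+j)/γ(n)) = A(n) j - δ(n)² j² + ∑_{i=3}^{d} gᵢ(n) jⁱ + o(δ(n)^d)` for `0 ≤ j ≤ d`. The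
paper derives this from the saddle-point asymptotics of Thm. 7; here it follows from the moment
formula `γ(n) = 64·4ⁿ n!/(2n)! ∫ Φ u^{2n}` (`XiMoments.lean`), the concentration of the
measures `Φ(u)u^k du` (`XiMomentConcentration.lean`), and elementary bookkeeping.
[cite: GORZPNAS2019, §5.1 eq. (15)] -/
theorem xiTaylorCoeff_logRatio_holds' : ∀ d : ℕ, 1 ≤ d → ∃ (A δ : ℕ → ℝ) (g : ℕ → ℕ → ℝ),
    (∀ᶠ n in atTop, 0 < δ n) ∧ Tendsto δ atTop (𝓝 0) ∧
    (∀ i, 3 ≤ i → i ≤ d → (g i) =o[atTop] fun n ↦ δ n ^ i) ∧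
    ∀ j : ℕ, j ≤ d → (fun n ↦ Real.log (xiTaylorCoeff (n + j) / xiTaylorCoeff n) -
        (A n * j - δ n ^ 2 * (j : ℝ) ^ 2 + ∑ i ∈ Icc 3 d, g i n * (j : ℝ) ^ i)) =o[atTop]
        fun n ↦ δ n ^ d := by
  intro d hd
  rcases le_or_gt 2 d with hd2 | hd2
  · exact xiTaylorCoeff_logRatio_of_two_le hd2
  · obtain rfl : d = 1 := by omega
    obtain ⟨A, δ, g, h1, h2, h3, h4⟩ := xiTaylorCoeff_logRatio_of_two_le (le_refl 2)
    refine ⟨A, δ, g, h1, h2, fun i hi hi' ↦ by omega, fun j hj ↦ ?_⟩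
    have h := h4 j (by omega)
    have hI : Icc 3 2 = (∅ : Finset ℕ) := by decide
    have hI' : Icc 3 1 = (∅ : Finset ℕ) := by decide
    simp only [hI, sum_empty] at h
    simp only [hI', sum_empty]
    refine h.trans_isBigO (IsBigO.of_bound' ?_)
    have hsmall : ∀ᶠ n in atTop, |δ n| ≤ 1 := by
      have := Metric.tendsto_nhds.1 h2 1 one_pos
      exact this.mono fun n hn ↦ by rw [Real.dist_0_eq_abs] at hn; exact hn.le
    filter_upwards [hsmall] with n hn
    rw [Real.norm_eq_abs, Real.norm_eq_abs, abs_pow, abs_pow, pow_one]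
    exact pow_le_of_le_one (abs_nonneg _) hn two_ne_zero

end GORZAsymp

/-- **Discharge of `Literature.NumberTheory.LFunctions.xiTaylorCoeff_logRatio`** (GORZ, PNAS 116 (2019), §5.1 eq. (15) for the
Taylor coefficients `γ(n)` of `(-1 + 4z²) Λ(1/2 + z)`): proved here from the moment formula for
`γ(n)` (`XiMoments.lean`) and the concentration of the measures `Φ(u) uᵏ du`
(`XiMomentConcentration.lean`, `XiKernelLaplace.lean`) instead of the paper's Thm. 7.
[cite: GORZPNAS2019, §5.1 eq. (15)] -/
theorem xiTaylorCoeff_logRatio_holds : xiTaylorCoeff_logRatio :=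
  GORZAsymp.xiTaylorCoeff_logRatio_holds'

end Literature.NumberTheory.LFunctions

end
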